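import Summits.Ventures.HodgeRepro2.T6N43BergmanPlaces
import Summits.Ventures.HodgeRepro2.T5U11Unimodular
import Mathlib.Analysis.CStarAlgebra.Matrix
import Mathlib.MeasureTheory.Measure.Haar.Basic

/-!
# T6N43HostCarriers — the N4.3 archimedean carriers IN HOST SHAPE: `U(2)` compact with its probability
Haar measure, `U(1,1)` (p1's `T5U11Unimodular.U11`) with a Haar measure, bundled as `BergmanPlaces` data

FILED by seat t6-p6 (gen 19, wave 1; staged gen 14 as a continuation-readiness artefact for the
RS-N4.3 lane of the lead's DRAFT seat map, route/lead-tools/g8/SEATMAP-DRAFT.md l. 26).  The toys of record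
(`N43Toy.bergmanToy`, T6N43BergmanToy) carry the archimedean places on the carriers `Unit` and `ℝ`; the host
datum `M : NAut3 C.F (NDatum.ofHostShadow …)` of the M2-final is an OPEN binder, and its archimedean component
`M.sA.d43` is only asserted Bergman-explicit through the residual `hxA : M.sA.d43 = XA.toPlaces` (ledger rows
86–89).  This file supplies what a host inhabitant of `M.sA.d43` needs from the N4.3 lane with NO print input:
the two real groups as CARRIERS with GENUINE Haar measures (Mathlib's `haarMeasure` on the compact group
`U(2) = Matrix.unitaryGroup (Fin 2) ℂ`, normalised to mass 1 by the choice `K₀ = ⊤`; Mathlib's `haar` on the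
locally compact group `U(1,1) = T5U11Unimodular.U11`, p401649), the tautological matrix maps `rep` (the
coercions) with their membership and measurability, and the bundles `ExplicitU2.host` / `BergmanU11.host` /
`BergmanPlaces.host` whose SCALAR and FOCK parameters (`m`, `ι`, `c`, `Lfac`, `τ`, `ν`, `r`, the Hilbert space
`E`) stay EXPLICIT ARGUMENTS — the continuation fixes them from the displays (Eischen–Liu §2.2 / Rühl (A.2f)),
not this file.  THEOREM N4.3 then holds on the host-shaped bundle by `archNonvanishing_bergman` with the five
displays as its only hypotheses (`host_archNonvanishing`).  Nothing here is a toy transfer to the host datum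
(ledger l. 383): `M` stays open; this is the carrier layer a host inhabitant would be assembled from.
Axioms: {propext, Classical.choice, Quot.sound}.  §8(d): uses an L-value-free non-vanishing device: NO.
-/

namespace Summit.Ventures.HodgeRepro2.T6

open MeasureTheory Matrix

namespace N43Host

/-! ### §1 `U(2)` is compact -/

/-- `U(2) ⊂ M₂(ℂ)` is a compact set: closed (`isClosed_unitary`) inside the compact product of the closed
unit discs, every entry of a unitary matrix having norm `≤ 1` (`entry_norm_bound_of_unitary`). -/
theorem isCompact_unitaryGroup_fin2 :
    IsCompact (Matrix.unitaryGroup (Fin 2) ℂ : Set (Matrix (Fin 2) (Fin 2) ℂ)) := by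
  have hbox : IsCompact ((Set.pi (Set.univ : Set (Fin 2)) fun _ : Fin 2 =>
      Set.pi (Set.univ : Set (Fin 2)) fun _ : Fin 2 => Metric.closedBall (0 : ℂ) 1) :
        Set (Matrix (Fin 2) (Fin 2) ℂ)) :=
    isCompact_univ_pi fun _ => isCompact_univ_pi fun _ => isCompact_closedBall (0 : ℂ) 1
  refine IsCompact.of_isClosed_subset hbox isClosed_unitary ?_
  intro U hU
  exact Set.mem_univ_pi.mpr fun i => Set.mem_univ_pi.mpr fun j =>
    Metric.mem_closedBall.mpr (by rw [dist_zero_right]; exact entry_norm_bound_of_unitary hU i j)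

/-- The compact unitary group `U(2)` as a type. -/
abbrev U2 : Type := Matrix.unitaryGroup (Fin 2) ℂ

/-- `U(2)` is compact (`isCompact_unitaryGroup_fin2`). -/
instance instCompactSpaceU2 : CompactSpace U2 :=
  isCompact_iff_compactSpace.mp isCompact_unitaryGroup_fin2

/-- `U(2)` is nonempty (the unit matrix). -/
instance instNonemptyU2 : Nonempty U2 := ⟨1⟩

/-- The Borel σ-algebra of `U(2)` (subspace topology of the matrix space). -/
noncomputable instance instMeasurableSpaceU2 : MeasurableSpace U2 := borel U2

/-- The measurable structure of `U(2)` is its Borel structure. -/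
instance instBorelSpaceU2 : BorelSpace U2 := ⟨rfl⟩

/-! ### §2 the probability Haar measure of `U(2)` -/

/-- The Haar measure of `U(2)` normalised by the whole (compact) group: `haarMeasure ⊤`. -/
noncomputable def haarU2 : Measure U2 := Measure.haarMeasure (⊤ : TopologicalSpace.PositiveCompacts U2)

/-- `haarU2` is a left Haar measure. -/
instance instIsHaarMeasureHaarU2 : haarU2.IsHaarMeasure :=
  Measure.isHaarMeasure_haarMeasure _

/-- `haarU2` has total mass `1` (`haarMeasure_self` with `K₀ = ⊤`). -/
theorem haarU2_univ : haarU2 Set.univ = 1 := by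
  have h := Measure.haarMeasure_self (G := U2) (K₀ := ⊤)
  rwa [TopologicalSpace.PositiveCompacts.coe_top] at h

/-- `haarU2` is a probability measure (TIER5 l. 1251: the compact place's Haar measure normalised to mass 1). -/
instance instIsProbabilityMeasureHaarU2 : IsProbabilityMeasure haarU2 := ⟨haarU2_univ⟩

/-- The tautological matrix map of `U(2)`. -/
noncomputable def repU2 (g : U2) : Matrix (Fin 2) (Fin 2) ℂ := (g : Matrix (Fin 2) (Fin 2) ℂ)

/-- `repU2 g` is a unitary matrix (the membership of the subtype). -/
theorem repU2_mem (g : U2) : repU2 g ∈ Matrix.unitaryGroup (Fin 2) ℂ := g.2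

/-- `repU2` is continuous (the subtype inclusion). -/
theorem continuous_repU2 : Continuous repU2 := continuous_subtype_val

/-- Each matrix entry of `repU2` is measurable. -/
theorem repU2_measurable (i j : Fin 2) : Measurable fun g => repU2 g i j :=
  (continuous_repU2.matrix_elem i j).measurable

/-! ### §3 `U(1,1)` with a Haar measure (p1's `T5U11Unimodular.U11`, a closed subgroup of `GL₂(ℂ)`) -/

/-- `U(1,1)` as a type: p1's subgroup `T5U11Unimodular.U11` of `GL₂(ℂ)` (locally compact, second countable,
unimodular — T5U11Unimodular). -/
abbrev U11 : Type := T5U11Unimodular.U11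

/-- The Borel σ-algebra of `U(1,1)` (subspace topology of `GL₂(ℂ)`). -/
noncomputable instance instMeasurableSpaceU11 : MeasurableSpace U11 := borel U11

/-- The measurable structure of `U(1,1)` is its Borel structure. -/
instance instBorelSpaceU11 : BorelSpace U11 := ⟨rfl⟩

/-- A Haar measure of `U(1,1)` (Mathlib's `haar`). -/
noncomputable def haarU11 : Measure U11 := Measure.haar

/-- `haarU11` is a left Haar measure. -/
instance instIsHaarMeasureHaarU11 : haarU11.IsHaarMeasure :=
  Measure.isHaarMeasure_haarMeasure _

/-- `U(1,1)` being unimodular (T5U11Unimodular), `haarU11` is also right-invariant. -/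
theorem haarU11_isMulRightInvariant : haarU11.IsMulRightInvariant :=
  T5U11Unimodular.isMulRightInvariant haarU11

/-- The tautological matrix map of `U(1,1)`: the underlying matrix of the unit. -/
noncomputable def repU11 (g : U11) : Matrix (Fin 2) (Fin 2) ℂ := ((g : GL (Fin 2) ℂ) : Matrix (Fin 2) (Fin 2) ℂ)

/-- `repU11 g` satisfies p1's membership predicate `MemU11` (the defining property of the subgroup). -/
theorem repU11_mem (g : U11) : T5UnitaryBound.MemU11 (repU11 g) :=
  (T5U11Unimodular.mem_U11_iff _).mp g.2

/-- `repU11` is continuous (the unit's value map composed with the subtype inclusion). -/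
theorem continuous_repU11 : Continuous repU11 :=
  Units.continuous_val.comp continuous_subtype_val

/-- Each matrix entry of `repU11` is measurable. -/
theorem repU11_measurable (i j : Fin 2) : Measurable fun g => repU11 g i j :=
  (continuous_repU11.matrix_elem i j).measurable

/-! ### §4 the host-shaped bundles (scalar / Fock parameters explicit) -/

/-- The compact place in host shape: carrier `U(2)`, probability Haar measure `haarU2`, tautological `rep`;
the Fock data `E`, `ι`, the integer `m`, the scalar `c`, the L-factor and the Eischen–Liu parameters are
arguments. -/
noncomputable def ExplicitU2.host (E : Type) [NormedAddCommGroup E] [InnerProductSpace ℂ E] (m : ℤ)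
    (ι : FockPoly →ₗ[ℂ] E) (c : ℂ) (hι : ι Delta ≠ 0) (hc : c ≠ 0) (Lfac : ℂ → ℂ) (τ : Fin 2 → ℤ)
    (ν : Fin 0 → ℤ) (r : ℤ) : N43Places.ExplicitU2 where
  H := U2
  meas := instMeasurableSpaceU2
  E := E
  normed := inferInstance
  inner := inferInstance
  m := m
  ι := ι
  c := c
  hι := hι
  hc := hc
  μ := haarU2
  prob := instIsProbabilityMeasureHaarU2
  rep := repU2
  rep_mem := repU2_mem
  rep_measurable := repU2_measurable
  Lfac := Lfac
  τ := τ
  ν := ν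
  r := r

/-- A `(1,1)`-place in host shape: carrier `U(1,1)`, Haar measure `haarU11`, tautological `rep`; the scalar
`c`, the L-factor and the Eischen–Liu parameters are arguments. -/
noncomputable def BergmanU11.host (c : ℂ) (hc : c ≠ 0) (Lfac : ℂ → ℂ) (τ ν : Fin 1 → ℤ) (r : ℤ) :
    N43Places.BergmanU11 where
  H := U11
  meas := instMeasurableSpaceU11
  μ := haarU11
  rep := repU11
  rep_mem := repU11_mem
  rep_measurable := repU11_measurable
  c := c
  hc := hc
  Lfac := Lfac
  τ := τ
  ν := ν
  r := r

/-- The three real places in host shape (`τ′₁` on `U(2)`, `τ′₂` and `τ′₃` on `U(1,1)`). -/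
noncomputable def BergmanPlaces.host (E : Type) [NormedAddCommGroup E] [InnerProductSpace ℂ E] (m : ℤ)
    (ι : FockPoly →ₗ[ℂ] E) (c₁ : ℂ) (hι : ι Delta ≠ 0) (hc₁ : c₁ ≠ 0) (L₁ : ℂ → ℂ) (τ₁ : Fin 2 → ℤ)
    (ν₁ : Fin 0 → ℤ) (r₁ : ℤ) (c₂ : ℂ) (hc₂ : c₂ ≠ 0) (L₂ : ℂ → ℂ) (τ₂ ν₂ : Fin 1 → ℤ) (r₂ : ℤ)
    (c₃ : ℂ) (hc₃ : c₃ ≠ 0) (L₃ : ℂ → ℂ) (τ₃ ν₃ : Fin 1 → ℤ) (r₃ : ℤ) : N43Places.BergmanPlaces where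
  p₁ := ExplicitU2.host E m ι c₁ hι hc₁ L₁ τ₁ ν₁ r₁
  p₂ := BergmanU11.host c₂ hc₂ L₂ τ₂ ν₂ r₂
  p₃ := BergmanU11.host c₃ hc₃ L₃ τ₃ ν₃ r₃

/-- The host-shaped bundle's carriers and measures are the real ones (definitional record). -/
theorem BergmanPlaces.host_carriers (E : Type) [NormedAddCommGroup E] [InnerProductSpace ℂ E] (m : ℤ)
    (ι : FockPoly →ₗ[ℂ] E) (c₁ : ℂ) (hι : ι Delta ≠ 0) (hc₁ : c₁ ≠ 0) (L₁ : ℂ → ℂ) (τ₁ : Fin 2 → ℤ)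
    (ν₁ : Fin 0 → ℤ) (r₁ : ℤ) (c₂ : ℂ) (hc₂ : c₂ ≠ 0) (L₂ : ℂ → ℂ) (τ₂ ν₂ : Fin 1 → ℤ) (r₂ : ℤ)
    (c₃ : ℂ) (hc₃ : c₃ ≠ 0) (L₃ : ℂ → ℂ) (τ₃ ν₃ : Fin 1 → ℤ) (r₃ : ℤ) :
    (BergmanPlaces.host E m ι c₁ hι hc₁ L₁ τ₁ ν₁ r₁ c₂ hc₂ L₂ τ₂ ν₂ r₂ c₃ hc₃ L₃ τ₃ ν₃ r₃).toPlaces.H₁ = U2 ∧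
    (BergmanPlaces.host E m ι c₁ hι hc₁ L₁ τ₁ ν₁ r₁ c₂ hc₂ L₂ τ₂ ν₂ r₂ c₃ hc₃ L₃ τ₃ ν₃ r₃).toPlaces.H₂ = U11 ∧
    (BergmanPlaces.host E m ι c₁ hι hc₁ L₁ τ₁ ν₁ r₁ c₂ hc₂ L₂ τ₂ ν₂ r₂ c₃ hc₃ L₃ τ₃ ν₃ r₃).toPlaces.H₃ = U11 ∧
    (BergmanPlaces.host E m ι c₁ hι hc₁ L₁ τ₁ ν₁ r₁ c₂ hc₂ L₂ τ₂ ν₂ r₂ c₃ hc₃ L₃ τ₃ ν₃ r₃).toPlaces.d₁.μ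
      = haarU2 ∧
    (BergmanPlaces.host E m ι c₁ hι hc₁ L₁ τ₁ ν₁ r₁ c₂ hc₂ L₂ τ₂ ν₂ r₂ c₃ hc₃ L₃ τ₃ ν₃ r₃).toPlaces.d₂.μ
      = haarU11 ∧
    (BergmanPlaces.host E m ι c₁ hι hc₁ L₁ τ₁ ν₁ r₁ c₂ hc₂ L₂ τ₂ ν₂ r₂ c₃ hc₃ L₃ τ₃ ν₃ r₃).toPlaces.d₃.μ
      = haarU11 :=
  ⟨rfl, rfl, rfl, rfl, rfl, rfl⟩

/-! ### §5 THEOREM N4.3 on the host-shaped bundle: the five displays are the only hypotheses -/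

/-- THEOREM N4.3 (c) — the archimedean non-vanishing `Z^*_{τ′_j}(1/2) ≠ 0`, `j = 1, 2, 3` — on the host-shaped
bundle, from the displays `Hyp.EischenLiu2024_Sec2_2` (×3) and `Hyp.Ruhl1970_A2f` (×2) alone
(`archNonvanishing_bergman`): no interface binder, no toy. -/
theorem host_archNonvanishing (E : Type) [NormedAddCommGroup E] [InnerProductSpace ℂ E] (m : ℤ)
    (ι : FockPoly →ₗ[ℂ] E) (c₁ : ℂ) (hι : ι Delta ≠ 0) (hc₁ : c₁ ≠ 0) (L₁ : ℂ → ℂ) (τ₁ : Fin 2 → ℤ)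
    (ν₁ : Fin 0 → ℤ) (r₁ : ℤ) (c₂ : ℂ) (hc₂ : c₂ ≠ 0) (L₂ : ℂ → ℂ) (τ₂ ν₂ : Fin 1 → ℤ) (r₂ : ℤ)
    (c₃ : ℂ) (hc₃ : c₃ ≠ 0) (L₃ : ℂ → ℂ) (τ₃ ν₃ : Fin 1 → ℤ) (r₃ : ℤ)
    (hEL₁ : Hyp.EischenLiu2024_Sec2_2 2 0 τ₁ ν₁ r₁ L₁)
    (hA2f₂ : Hyp.Ruhl1970_A2f (BergmanU11.host c₂ hc₂ L₂ τ₂ ν₂ r₂).datum)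
    (hEL₂ : Hyp.EischenLiu2024_Sec2_2 1 1 τ₂ ν₂ r₂ L₂)
    (hA2f₃ : Hyp.Ruhl1970_A2f (BergmanU11.host c₃ hc₃ L₃ τ₃ ν₃ r₃).datum)
    (hEL₃ : Hyp.EischenLiu2024_Sec2_2 1 1 τ₃ ν₃ r₃ L₃) :
    (BergmanPlaces.host E m ι c₁ hι hc₁ L₁ τ₁ ν₁ r₁ c₂ hc₂ L₂ τ₂ ν₂ r₂ c₃ hc₃ L₃ τ₃ ν₃ r₃).toPlaces.ArchNonvanishing :=
  N43Places.BergmanPlaces.archNonvanishing_bergman _ hEL₁ hA2f₂ hEL₂ hA2f₃ hEL₃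

end N43Host

end Summit.Ventures.HodgeRepro2.T6
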